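import Summits.CriticalPhenomena.CardyFormulaZ2.Theses.CardyQContinuation

/-!
# Crux `IsingJetsConformal`, stub `stub_loopSymmetricLimit_pathUpper`:
# the deterministic path lemma of the upper sandwich of the `n = 0` bridge
# (route `CardyQContinuation`, item stmt-CriticalPhenomena-5560)

A graph `G` on `V` carries a distinguished edge set `EQ` (the quadrilateral edges); every edge of
`G` outside `EQ` has BOTH endpoints in the wired set `Z₀ ∪ Z₂`, the two blocks `Z₀`, `Z₂` are
disjoint and no edge of `G` joins them. Claim: if a bond configuration `ω ⊆ E(G)` contains an open
path from a vertex of `Z₀` to a vertex of `Z₂`, then it contains an open path running on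
`EQ`-edges only, from a vertex `x' ∈ Z₀` to a vertex `y' ∈ Z₂`, each of which is an endpoint of an
open `EQ`-edge.

Proof (walk surgery, by induction on the walk). For a walk `u = u₀ ∼ u₁ ∼ ⋯ ∼ uₙ = v` of the open
graph with `v ∈ Z₂` we prove simultaneously: (a) if `u ∈ Z₀` the conclusion holds; (b) if
`u ∉ Z₀ ∪ Z₂` then either the conclusion holds or some `y' ∈ Z₂` incident to an open `EQ`-edge is
joined to `u` in the open graph of `ω ∩ EQ`. The key remark is that an open edge with an endpoint
outside `Z₀ ∪ Z₂` is an open `EQ`-edge (it is an edge of `G`, and non-`EQ` edges of `G` have both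
endpoints wired), and that an open edge never joins `Z₀` to `Z₂`. The step `u ∼ w ⋯` then splits
according to whether `w ∈ Z₀`, `w ∈ Z₂` or neither, prepending the open `EQ`-edge `u w` to the
path provided by the induction hypothesis when `u` or `w` is unwired.

References: G. Grimmett, *Percolation* (1999), §1.3 (open paths); the statement is elementary
graph theory and carries no further source.
-/

namespace Summit.CriticalPhenomena.CardyFormulaZ2.Theorems.CardyQContinuation

open Literature.Probability.Percolation

namespace PathUpper

variable {V : Type*} {G : SimpleGraph V} {EQ : Set (Sym2 V)} {Z₀ Z₂ : Set V} {ω : Set (Sym2 V)}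

/-- An open edge `u w` (`ω ⊆ E(G)`, non-`EQ` edges of `G` wired at both ends) whose first endpoint
`u` is unwired is an open `EQ`-edge. -/
theorem mk_mem_inter_of_left_not_mem (hω : ω ⊆ G.edgeSet)
    (hEQ : ∀ e ∈ G.edgeSet, e ∉ EQ → ∀ x ∈ e, x ∈ Z₀ ∪ Z₂) {u w : V}
    (h : (openGraph ω).Adj u w) (hu : u ∉ Z₀ ∪ Z₂) : s(u, w) ∈ ω ∩ EQ := by
  rw [openGraph_adj] at h
  refine ⟨h.1, ?_⟩
  by_contra hne
  exact hu (hEQ _ (hω h.1) hne u (Sym2.mem_mk_left u w))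

/-- An open edge `u w` whose second endpoint `w` is unwired is an open `EQ`-edge. -/
theorem mk_mem_inter_of_right_not_mem (hω : ω ⊆ G.edgeSet)
    (hEQ : ∀ e ∈ G.edgeSet, e ∉ EQ → ∀ x ∈ e, x ∈ Z₀ ∪ Z₂) {u w : V}
    (h : (openGraph ω).Adj u w) (hw : w ∉ Z₀ ∪ Z₂) : s(u, w) ∈ ω ∩ EQ := by
  rw [openGraph_adj] at h
  refine ⟨h.1, ?_⟩
  by_contra hne
  exact hw (hEQ _ (hω h.1) hne w (Sym2.mem_mk_right u w))

/-- An open `EQ`-edge `u w` with `u ≠ w` is an edge of the open graph of `ω ∩ EQ`. -/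
theorem adj_inter_of_mem {u w : V} (h : s(u, w) ∈ ω ∩ EQ) (hne : u ≠ w) :
    (openGraph (ω ∩ EQ)).Adj u w :=
  (openGraph_adj (ω ∩ EQ) u w).2 ⟨h, hne⟩

/-- No open edge joins `Z₀` to `Z₂` (open edges are edges of `G`). -/
theorem not_adj_of_mem (hω : ω ⊆ G.edgeSet) (hfar : ∀ x ∈ Z₀, ∀ y ∈ Z₂, ¬ G.Adj x y) {u w : V}
    (hu : u ∈ Z₀) (hw : w ∈ Z₂) : ¬ (openGraph ω).Adj u w := by
  intro h
  rw [openGraph_adj] at h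
  exact hfar u hu w hw ((SimpleGraph.mem_edgeSet G).1 (hω h.1))

/-- The inductive core of the path lemma. For an open walk `p` from `u` to `v ∈ Z₂`:
(a) if `u ∈ Z₀`, there are `x' ∈ Z₀`, `y' ∈ Z₂`, each an endpoint of an open `EQ`-edge, joined in
the open graph of `ω ∩ EQ`; (b) if `u` is unwired, either (a)'s conclusion holds or some `y' ∈ Z₂`
that is an endpoint of an open `EQ`-edge is joined to `u` in the open graph of `ω ∩ EQ`. -/
theorem walk_aux (hω : ω ⊆ G.edgeSet)
    (hEQ : ∀ e ∈ G.edgeSet, e ∉ EQ → ∀ x ∈ e, x ∈ Z₀ ∪ Z₂)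
    (hfar : ∀ x ∈ Z₀, ∀ y ∈ Z₂, ¬ G.Adj x y) (hdisj : Disjoint Z₀ Z₂)
    {u v : V} (p : (openGraph ω).Walk u v) (hv : v ∈ Z₂) :
    (u ∈ Z₀ → ∃ x' ∈ Z₀, ∃ y' ∈ Z₂, (∃ e ∈ ω ∩ EQ, x' ∈ e) ∧ (∃ e ∈ ω ∩ EQ, y' ∈ e) ∧
        (openGraph (ω ∩ EQ)).Reachable x' y') ∧
    (u ∉ Z₀ ∪ Z₂ → (∃ x' ∈ Z₀, ∃ y' ∈ Z₂, (∃ e ∈ ω ∩ EQ, x' ∈ e) ∧ (∃ e ∈ ω ∩ EQ, y' ∈ e) ∧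
        (openGraph (ω ∩ EQ)).Reachable x' y') ∨
      ∃ y' ∈ Z₂, (∃ e ∈ ω ∩ EQ, y' ∈ e) ∧ (openGraph (ω ∩ EQ)).Reachable u y') := by
  induction p with
  | nil =>
    exact ⟨fun hu => absurd hv (Set.disjoint_left.1 hdisj hu), fun hu => absurd (Or.inr hv) hu⟩
  | @cons u w v h p ih =>
    obtain ⟨ih₀, ih₁⟩ := ih hv
    refine ⟨fun hu => ?_, fun hu => ?_⟩
    · -- `u ∈ Z₀`
      by_cases hw₀ : w ∈ Z₀
      · exact ih₀ hw₀
      by_cases hw₂ : w ∈ Z₂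
      · exact absurd h (not_adj_of_mem hω hfar hu hw₂)
      have hw : w ∉ Z₀ ∪ Z₂ := fun hw => hw.elim hw₀ hw₂
      have he : s(u, w) ∈ ω ∩ EQ := mk_mem_inter_of_right_not_mem hω hEQ h hw
      rcases ih₁ hw with hc | ⟨y', hy', hy'e, hwy'⟩
      · exact hc
      exact ⟨u, hu, y', hy', ⟨s(u, w), he, Sym2.mem_mk_left u w⟩, hy'e,
        (adj_inter_of_mem he h.ne).reachable.trans hwy'⟩
    · -- `u` unwired
      have he : s(u, w) ∈ ω ∩ EQ := mk_mem_inter_of_left_not_mem hω hEQ h hu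
      have huw : (openGraph (ω ∩ EQ)).Adj u w := adj_inter_of_mem he h.ne
      by_cases hw₀ : w ∈ Z₀
      · exact Or.inl (ih₀ hw₀)
      by_cases hw₂ : w ∈ Z₂
      · exact Or.inr ⟨w, hw₂, ⟨s(u, w), he, Sym2.mem_mk_right u w⟩, huw.reachable⟩
      have hw : w ∉ Z₀ ∪ Z₂ := fun hw => hw.elim hw₀ hw₂
      rcases ih₁ hw with hc | ⟨y', hy', hy'e, hwy'⟩
      · exact Or.inl hc
      exact Or.inr ⟨y', hy', hy'e, huw.reachable.trans hwy'⟩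

end PathUpper

/-- **stub_loopSymmetricLimit_pathUpper** (P1, the deterministic half of the upper sandwich of the
`n = 0` bridge). Let `EQ ⊆ Sym2 V`, let every edge of `G` outside `EQ` have both endpoints in
`Z₀ ∪ Z₂`, let no edge of `G` join `Z₀` to `Z₂`, and let `Z₀`, `Z₂` be disjoint. If a configuration
`ω ⊆ E(G)` joins some `x ∈ Z₀` to some `y ∈ Z₂` by an open path, then some `x' ∈ Z₀` and
`y' ∈ Z₂`, each an endpoint of an open `EQ`-edge, are joined by an open path of `ω ∩ EQ`. -/
theorem stub_loopSymmetricLimit_pathUpper : (∀ (V : Type) (G : SimpleGraph V) (EQ : Set (Sym2 V)) (Z₀ Z₂ : Set V) (ω : Set (Sym2 V)), ω ⊆ G.edgeSet → (∀ e ∈ G.edgeSet, e ∉ EQ → ∀ x ∈ e, x ∈ Z₀ ∪ Z₂) → (∀ x ∈ Z₀, ∀ y ∈ Z₂, ¬ G.Adj x y) → Disjoint Z₀ Z₂ → ∀ x ∈ Z₀, ∀ y ∈ Z₂, (Literature.Probability.Percolation.openGraph ω).Reachable x y → ∃ x' ∈ Z₀, ∃ y' ∈ Z₂, (∃ e ∈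 ω ∩ EQ, x' ∈ e) ∧ (∃ e ∈ ω ∩ EQ, y' ∈ e) ∧ (Literature.Probability.Percolation.openGraph (ω ∩ EQ)).Reachable x' y') := by
  intro V G EQ Z₀ Z₂ ω hω hEQ hfar hdisj x hx y hy hxy
  obtain ⟨p⟩ := hxy
  exact (PathUpper.walk_aux hω hEQ hfar hdisj p hy).1 hx

end Summit.CriticalPhenomena.CardyFormulaZ2.Theorems.CardyQContinuation
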